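import Literature.MathematicalPhysics.QuantumFieldTheory.Balaban1983to89.HiggsHodgeIdentity

/-!
# `Balaban1983to89.HiggsGaugeInvariance` — T. Bałaban, *(Higgs)₂,₃ quantum fields in a finite volume. I. A lower bound*,
Commun. Math. Phys. **85** (1982) 603–626 [Balaban1982Higgs1], p. 605, (1.7)–(1.11): the abelian GAUGE TRANSFORMATIONS
`(A, φ) ↦ (A − ∂^ελ, U(λ)φ)` of the lattice Higgs model, the gauge COVARIANCE of the covariant derivative (1.7), the gauge
INVARIANCE of the action (1.8) minus its Proca mass term, the invariance of the Lebesgue measure `dA dφ` of (1.9)/(1.10), and the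
connectedness of the torus (`∂^ελ = 0 ⇒ λ` constant) — *"the properties of (1.8) under the gauge transformations"* (p. 605) —
PROVED on the CONCRETE carrier `…Balaban1983to89.HiggsLattice`

statement-level skeleton of published theorems with citation tags; proofs where landed; nothing here is a claim about the Yang–Mills mass gap

PDF held: `paper:balaban1982-cmp85-higgs23-i` (journal page = PDF page + 602); p. 605 [PDF 3].

WHAT IS REPRODUCED (SKELETON rows **B1.Eq1.7**, **B1.Eq1.8**, **B1.Eq1.9-1.10**, owners r01/r14; second of the five lit-balaban
seat-p28 (gen 8) files on the passage (1.9) → (1.10)).  p. 605, verbatim: *"Z'^ε = ∫dA∫dφ exp(−S'^ε(A,φ)). (1.9) In the above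
integral the natural Lebesgue measure is used on the spaces of configurations of scalar and vector fields. We will now use some
results of the paper [5]. In Sect. 5.1 the authors have shown how to introduce the gauge fixing terms in the integral (1.9), using
the properties of (1.8) under the gauge transformations."* ([5] = Brydges–Fröhlich–Seiler, *On the construction of quantized gauge
fields. I*, Ann. Phys. **121** (1979) [BrydgesFrohlichSeiler1979], NOT HELD (acquisition request acq-09341): nothing below is
quoted from it; everything is proved.)  On the carriers of `…HiggsLattice` (`ChargeData.U η A = exp(qηeA)` (1.7), `covDeriv`,
`covLaplaceForm`, `potential`, `curl`, `actionPrime` (1.8), `action` (1.11)) and of `…HiggsHodgeIdentity` (`grad`, `div`,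
`bondSq`, `siteSq`, `divTerm`):
* §3 the gauge-INVARIANT part `Sinv` of (1.8) and the Proca mass term `massTerm`: `actionPrime = Sinv + ½μ₀²‖A‖²_η`
  (`actionPrime_eq`), `action = Sinv + ½μ₀²‖A‖²_η + ½‖∂^{η*}A‖²_η + E` (`action_eq`); the gauge transformation `gaugeVec` / `rot` /
  `gaugeMap`; **`(D^η_{A−∂^ηλ}(U(λ)φ))(b) = U(λ(b₋))·(D^η_Aφ)(b)`** (`covDeriv_gauge`), hence the invariance of `covLaplaceForm`,
  `potential`, the curl term and of `Sinv` (`Sinv_gauge`, `Sinv_gaugeMap`); `∂^{η*}(A − ∂^ηλ) = ∂^{η*}A − ∂^{η*}∂^ηλ` (`div_gaugeVec`: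
  the mass and gauge-fixing terms are NOT invariant — what the gauge fixing exploits);
* §4 **the gauge transformation preserves `dA dφ`** (`measurePreserving_gaugeMap`: a translation of `A` times a product over the
  sites of the rotations `U(λ(x))` of `R^N`), and `∂^ηλ = 0 ⇒ λ = λ(x₀)` (`eq_default_of_grad_eq_zero`, by walking the torus).
Nothing of [Balaban1982Higgs1] beyond the quoted sentence is asserted; no `Prop`-valued fact is introduced.  Unit `lit-balaban-p28`
(Phase-2 proof seat p28, gen 8; DEPGRAPH node `EXT:BFS1979` at its B1 use), HOME `run/shared/lean/pub/lit-balaban/`.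
-/

open scoped BigOperators InnerProductSpace
open _root_.MeasureTheory

namespace Literature.MathematicalPhysics.QuantumFieldTheory.Balaban1983to89.HiggsGaugeInvariance

open HiggsLattice HiggsCovariancePos HiggsHodgeIdentity

variable {P : Params} {k N : ℕ}

noncomputable section

/-! ## §3 Gauge transformations and the invariant part of (1.8) -/

/-- The gauge-INVARIANT part of the action (1.8): `½Σ_b η^d|(D^η_Aφ)(b)|² + Σ_x η^d(½m₀²|φ|² + λ|φ|⁴) + ½Σ_P η^d|(∂^ηA)(P)|²`
((1.8) minus its Proca mass term). [cite: Balaban1982Higgs1, (1.8) p.605] -/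
def Sinv (C : ChargeData N) (c : Couplings) (A : VecField P k) (φ : ScalarField P k N) : ℝ :=
  covLaplaceForm C A φ / 2 + potential c φ + (∑ p : Plaq P k, P.mesh k ^ P.d * (curl A p) ^ 2) / 2

/-- The Proca mass term `½ Σ_b η^d μ₀² A_b² = ½μ₀²‖A‖²_η` of (1.8)/(1.11). [cite: Balaban1982Higgs1, (1.8) p.605] -/
def massTerm (mu0sq : ℝ) (A : VecField P k) : ℝ := mu0sq * bondSq A / 2

/-- `massTerm` is the mass term as written in `HiggsLattice.actionPrime`. [cite: Balaban1982Higgs1, (1.8) p.605] -/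
theorem massTerm_eq (mu0sq : ℝ) (A : VecField P k) :
    massTerm mu0sq A = (∑ b : PBond P k, P.mesh k ^ P.d * (mu0sq * (A b) ^ 2)) / 2 := by
  unfold massTerm bondSq
  rw [Finset.mul_sum]
  congr 1
  exact Finset.sum_congr rfl fun b _ => by ring

/-- **(1.8) = invariant part + mass term.** [cite: Balaban1982Higgs1, (1.8) p.605] -/
theorem actionPrime_eq (C : ChargeData N) (c : Couplings) (A : VecField P k) (φ : ScalarField P k N) :
    actionPrime C c A φ = Sinv C c A φ + massTerm c.mu0sq A := by
  rw [massTerm_eq]; unfold actionPrime Sinv; ring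

/-- **(1.11) = invariant part + mass term + gauge-fixing term + E.** [cite: Balaban1982Higgs1, (1.11) p.605] -/
theorem action_eq (C : ChargeData N) (c : Couplings) (A : VecField P k) (φ : ScalarField P k N) :
    action C c A φ = Sinv C c A φ + massTerm c.mu0sq A + divTerm A + c.E := by
  rw [action_eq_actionPrime_add_divTerm, actionPrime_eq]

/-- The gauge transformation of the vector field by a gauge function `λ : T^{(k)} → R`: `A ↦ A − ∂^ηλ`.
[cite: Balaban1982Higgs1, (1.8) p.605] -/
def gaugeVec (lam : Site P k → ℝ) (A : VecField P k) : VecField P k := A - grad lam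

/-- The simultaneous gauge transformation of the scalar field: `φ(x) ↦ U(λ(x))φ(x)` with the representation `U` of (1.7)
(`U(η·(η⁻¹λ(x))) = exp(qeλ(x))`). [cite: Balaban1982Higgs1, (1.7) p.605] -/
def rot (C : ChargeData N) (lam : Site P k → ℝ) (φ : ScalarField P k N) : ScalarField P k N :=
  fun x => C.U (P.mesh k) ((P.mesh k)⁻¹ * lam x) (φ x)

/-- The gauge transformation of a configuration `(A, φ)`. [cite: Balaban1982Higgs1, (1.8) p.605] -/
def gaugeMap (C : ChargeData N) (lam : Site P k → ℝ) (Φ : VecField P k × ScalarField P k N) :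
    VecField P k × ScalarField P k N :=
  (gaugeVec lam Φ.1, rot C lam Φ.2)

/-- gauge transformations of the scalar field compose additively (`U(a)(U(b)v) = U(a+b)v`: `HiggsLattice.ChargeData.U_add`; the
applied form is `B2Ineq329CovariantAveraging.U_apply_U` in the tree, not imported here to keep this (1.7)-level file below the B2
averaging machinery). [cite: Balaban1982Higgs1, (1.7) p.605] -/
theorem rot_add (C : ChargeData N) (lam lam' : Site P k → ℝ) (φ : ScalarField P k N) :
    rot C (lam + lam') φ = rot C lam (rot C lam' φ) := by
  have hUU : ∀ (a b : ℝ) (v : EuclideanSpace ℝ (Fin N)),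
      C.U (P.mesh k) a (C.U (P.mesh k) b v) = C.U (P.mesh k) (a + b) v := fun a b v => by
    rw [ChargeData.U_add]; rfl
  funext x
  simp only [rot, Pi.add_apply, hUU]
  congr 2; ring

/-- the trivial gauge function acts trivially. [cite: Balaban1982Higgs1, (1.7) p.605] -/
theorem rot_zero (C : ChargeData N) (φ : ScalarField P k N) : rot C (0 : Site P k → ℝ) φ = φ := by
  funext x; simp [rot, ChargeData.U_zero]

/-- `−λ` undoes `λ` on the scalar field. [cite: Balaban1982Higgs1, (1.7) p.605] -/
theorem rot_neg_rot (C : ChargeData N) (lam : Site P k → ℝ) (φ : ScalarField P k N) : rot C (-lam) (rot C lam φ) = φ := by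
  rw [← rot_add, neg_add_cancel, rot_zero]

/-- `λ` undoes `−λ` on the scalar field. [cite: Balaban1982Higgs1, (1.7) p.605] -/
theorem rot_rot_neg (C : ChargeData N) (lam : Site P k → ℝ) (φ : ScalarField P k N) : rot C lam (rot C (-lam) φ) = φ := by
  rw [← rot_add, add_neg_cancel, rot_zero]

/-- `‖U(θ)v‖ = ‖v‖` (p. 605: *"unitary operators on R^N"*). [cite: Balaban1982Higgs1, (1.7) p.605] -/
theorem norm_U (C : ChargeData N) (η θ : ℝ) (v : EuclideanSpace ℝ (Fin N)) : ‖C.U η θ v‖ = ‖v‖ :=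
  ContinuousLinearMap.norm_map_of_mem_unitary (C.U_mem_unitary η θ) v

/-- **The covariant derivative (1.7) is gauge COVARIANT**: `(D^η_{A−∂^ηλ}(U(λ)φ))(b) = U(λ(b₋))·(D^η_Aφ)(b)` — "the properties of
(1.8) under the gauge transformations" (p. 605). [cite: Balaban1982Higgs1, (1.7) p.605] -/
theorem covDeriv_gauge (C : ChargeData N) (lam : Site P k → ℝ) (A : VecField P k) (φ : ScalarField P k N) (b : PBond P k) :
    covDeriv C (gaugeVec lam A) (rot C lam φ) b = C.U (P.mesh k) ((P.mesh k)⁻¹ * lam b.src) (covDeriv C A φ b) := by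
  have hη : (P.mesh k) ≠ 0 := (P.mesh_pos k).ne'
  have hUU : ∀ (a b : ℝ) (v : EuclideanSpace ℝ (Fin N)),
      C.U (P.mesh k) a (C.U (P.mesh k) b v) = C.U (P.mesh k) (a + b) v := fun a b v => by
    rw [ChargeData.U_add]; rfl
  simp only [covDeriv, gaugeVec, rot, grad, Pi.sub_apply, hUU, map_smul, map_sub]
  congr 4
  field_simp
  ring

/-- hence `|(D^η_{A−∂λ}(U(λ)φ))(b)| = |(D^η_Aφ)(b)|`. [cite: Balaban1982Higgs1, (1.7) p.605] -/
theorem norm_covDeriv_gauge (C : ChargeData N) (lam : Site P k → ℝ) (A : VecField P k) (φ : ScalarField P k N) (b : PBond P k) :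
    ‖covDeriv C (gaugeVec lam A) (rot C lam φ) b‖ = ‖covDeriv C A φ b‖ := by
  rw [covDeriv_gauge, norm_U]

/-- `⟨φ,(−Δ^η_A)φ⟩` is gauge invariant. [cite: Balaban1982Higgs1, (1.11) p.605] -/
theorem covLaplaceForm_gauge (C : ChargeData N) (lam : Site P k → ℝ) (A : VecField P k) (φ : ScalarField P k N) :
    covLaplaceForm C (gaugeVec lam A) (rot C lam φ) = covLaplaceForm C A φ := by
  unfold covLaplaceForm; simp_rw [norm_covDeriv_gauge]

/-- the scalar self-interaction is gauge invariant (sitewise unitaries). [cite: Balaban1982Higgs1, (1.8) p.605] -/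
theorem potential_gauge (C : ChargeData N) (c : Couplings) (lam : Site P k → ℝ) (φ : ScalarField P k N) :
    potential c (rot C lam φ) = potential c φ := by
  unfold potential; simp only [rot, norm_U]

/-- `∂^η(∂^ηλ) = 0` on every plaquette (curl of a gradient). [cite: Balaban1982Higgs1, (1.6) p.604] -/
theorem curl_grad (lam : Site P k → ℝ) (p : Plaq P k) : curl (grad lam) p = 0 := by
  simp only [curl, grad, PBond.tgt]
  rw [shift_comm p.src p.ν p.μ]
  ring

/-- the plaquette field (1.6) is gauge invariant: `∂^η(A − ∂^ηλ) = ∂^ηA`. [cite: Balaban1982Higgs1, (1.6) p.604] -/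
theorem curl_gauge (lam : Site P k → ℝ) (A : VecField P k) (p : Plaq P k) : curl (gaugeVec lam A) p = curl A p := by
  have h : curl (gaugeVec lam A) p = curl A p - curl (grad lam) p := by
    simp only [curl, gaugeVec, Pi.sub_apply]; ring
  rw [h, curl_grad, sub_zero]

/-- **GAUGE INVARIANCE of the invariant part of (1.8).** [cite: Balaban1982Higgs1, (1.8) p.605] -/
theorem Sinv_gauge (C : ChargeData N) (c : Couplings) (lam : Site P k → ℝ) (A : VecField P k) (φ : ScalarField P k N) :
    Sinv C c (gaugeVec lam A) (rot C lam φ) = Sinv C c A φ := by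
  unfold Sinv
  rw [covLaplaceForm_gauge, potential_gauge]
  simp_rw [curl_gauge]

/-- the same, on configurations. [cite: Balaban1982Higgs1, (1.8) p.605] -/
theorem Sinv_gaugeMap (C : ChargeData N) (c : Couplings) (lam : Site P k → ℝ) (Φ : VecField P k × ScalarField P k N) :
    Sinv C c (gaugeMap C lam Φ).1 (gaugeMap C lam Φ).2 = Sinv C c Φ.1 Φ.2 :=
  Sinv_gauge C c lam Φ.1 Φ.2

/-- the divergence of the transformed field: `∂^{η*}(A − ∂^ηλ) = ∂^{η*}A − ∂^{η*}∂^ηλ` (the mass and gauge-fixing terms are NOT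
invariant — this is what the gauge fixing of (1.10) exploits). [cite: Balaban1982Higgs1, (1.11) p.605] -/
theorem div_gaugeVec (lam : Site P k → ℝ) (A : VecField P k) : div (gaugeVec lam A) = div A - div (grad lam) := by
  unfold gaugeVec; rw [div_sub]

/-! ## §4 Measure preservation and connectedness of the torus -/

/-- `U(θ)` as a linear isometric equivalence of `R^N`. [cite: Balaban1982Higgs1, (1.7) p.605] -/
def Uiso (C : ChargeData N) (η θ : ℝ) : EuclideanSpace ℝ (Fin N) ≃ₗᵢ[ℝ] EuclideanSpace ℝ (Fin N) :=
  Unitary.linearIsometryEquiv ⟨C.U η θ, C.U_mem_unitary η θ⟩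

/-- `Uiso` acts as `U(θ)`. [cite: Balaban1982Higgs1, (1.7) p.605] -/
theorem Uiso_apply (C : ChargeData N) (η θ : ℝ) (v : EuclideanSpace ℝ (Fin N)) : Uiso C η θ v = C.U η θ v := rfl

/-- the scalar gauge transformation is continuous. [cite: Balaban1982Higgs1, (1.7) p.605] -/
theorem continuous_rot (C : ChargeData N) (lam : Site P k → ℝ) : Continuous (rot C lam : ScalarField P k N → ScalarField P k N) :=
  continuous_pi fun x => (C.U (P.mesh k) ((P.mesh k)⁻¹ * lam x)).continuous.comp (continuous_apply x)

/-- **the scalar gauge transformation preserves `dφ`** (a product over the sites of rotations of `R^N`).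
[cite: Balaban1982Higgs1, (1.9) p.605] -/
theorem measurePreserving_rot (C : ChargeData N) (lam : Site P k → ℝ) :
    MeasurePreserving (rot C lam : ScalarField P k N → ScalarField P k N) volume volume :=
  volume_preserving_pi (α' := fun _ : Site P k => EuclideanSpace ℝ (Fin N)) (β' := fun _ : Site P k => EuclideanSpace ℝ (Fin N))
    (f := fun x v => Uiso C (P.mesh k) ((P.mesh k)⁻¹ * lam x) v) fun x => (Uiso C (P.mesh k) ((P.mesh k)⁻¹ * lam x)).measurePreserving

/-- the vector gauge transformation (a translation) preserves `dA`. [cite: Balaban1982Higgs1, (1.9) p.605] -/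
theorem measurePreserving_gaugeVec (lam : Site P k → ℝ) :
    MeasurePreserving (gaugeVec lam : VecField P k → VecField P k) volume volume :=
  measurePreserving_sub_right volume (grad lam)

/-- **the gauge transformation preserves the Lebesgue measure `dA dφ`** of (1.9)/(1.10). [cite: Balaban1982Higgs1, (1.9) p.605] -/
theorem measurePreserving_gaugeMap (C : ChargeData N) (lam : Site P k → ℝ) :
    MeasurePreserving (gaugeMap C lam : VecField P k × ScalarField P k N → VecField P k × ScalarField P k N) volume volume :=
  (measurePreserving_gaugeVec lam).prod (measurePreserving_rot C lam)

/-- the gauge transformation is continuous on configuration space. [cite: Balaban1982Higgs1, (1.9) p.605] -/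
theorem continuous_gaugeMap (C : ChargeData N) (lam : Site P k → ℝ) :
    Continuous (gaugeMap C lam : VecField P k × ScalarField P k N → VecField P k × ScalarField P k N) :=
  ((continuous_fst.sub continuous_const)).prodMk ((continuous_rot C lam).comp continuous_snd)

/-- iterated translation in direction `μ`: `m` shifts move the `μ`-th label by `m`. [folklore] -/
private theorem shift_iterate (μ : Fin P.d) (m : ℕ) (x : Site P k) :
    (fun y : Site P k => y.shift μ)^[m] x = Function.update x μ (x μ + m) := by
  induction m with
  | zero => simp
  | succ m ih =>
    rw [Function.iterate_succ_apply', ih]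
    simp only [Site.shift, Function.update_self, Function.update_idem]
    congr 1
    push_cast
    ring

/-- **Connectedness of the torus**: a gauge function with `∂^ηλ = 0` is constant. [cite: Balaban1982Higgs1, (1.2) p.604] -/
theorem eq_default_of_grad_eq_zero {lam : Site P k → ℝ} (h : grad lam = 0) (x : Site P k) : lam x = lam default := by
  have hstep : ∀ (y : Site P k) (μ : Fin P.d), lam (y.shift μ) = lam y := by
    intro y μ
    have hb := congr_fun h ⟨y, μ⟩
    simp only [grad, Pi.zero_apply, mul_eq_zero, inv_eq_zero, (P.mesh_pos k).ne', false_or, sub_eq_zero] at hb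
    exact hb
  have hiter : ∀ (m : ℕ) (y : Site P k) (μ : Fin P.d), lam ((fun z : Site P k => z.shift μ)^[m] y) = lam y := by
    intro m; induction m with
    | zero => intro y μ; rfl
    | succ m ih => intro y μ; rw [Function.iterate_succ_apply', hstep, ih]
  have hzero : ∀ (y : Site P k) (μ : Fin P.d), lam (Function.update y μ 0) = lam y := by
    intro y μ
    have hm := hiter ((-(y μ)).val) y μ
    rw [shift_iterate, ZMod.natCast_zmod_val, add_neg_cancel] at hm
    exact hm
  -- zero out the coordinates one by one
  have hset : ∀ s : Finset (Fin P.d), lam (fun μ => if μ ∈ s then 0 else x μ) = lam x := by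
    intro s
    induction s using Finset.induction_on with
    | empty => simp
    | insert μ s hμ ih =>
      have hupd : (fun ν => if ν ∈ insert μ s then (0 : ZMod (P.sitesPerDir k ν)) else x ν)
          = Function.update (fun ν => if ν ∈ s then 0 else x ν) μ 0 := by
        funext ν
        by_cases hν : ν = μ
        · subst hν; simp
        · simp [hν]
      rw [hupd, hzero, ih]
  have h := hset Finset.univ
  simp only [Finset.mem_univ, if_true] at h
  rw [← h]
  rfl

end

end Literature.MathematicalPhysics.QuantumFieldTheory.Balaban1983to89.HiggsGaugeInvariance
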